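import Summits.HodgeConjecture.CorCM.Census.QuarticInversionClosingS

/-!
# The quartic inversion twists, XI: the mixed closing faces and the values of the functionals on them

COR-CM (cell `pub-hodgecm2`, stage 2 of the Hodge ladder), count-neutral KERNEL COMBINATORICS by the binder seat b23 (gen 44; claim
QUARTIC-INVERSION, HOME/INBOX.md l.12829).  Part XI of the lane `Census/QuarticInversion*`, on top of parts I–X, all BY NAME.  One bookkeeping
definition with a body (`mixFace`) + theorems; no `Prop`-valued definition, no `decide` beyond closed identities in `ZMod 2`/`Bool`, no
certificate, no named fact, no geometry, no `sorry`.  `Interfaces.lean` (C1), every E term, B01, `Transposition/*`, `PortJoin/*` untouched.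
HONEST FRAMING: `HC_CM` is NOT proved, here or anywhere in the tree; nothing here is a period, a count of record or a headline.

CONTENT (`|B| = 2K + 1 ≥ 3`).  The second kind of closing face of the lane flips coordinate `0` across the equator AND an atom coordinate
`i ≠ 0` off the zero slice:
* §1 **Indicator labels flipped at `(i,u)`**: every half is unchanged (`0 ↦ δ u` stays low, `𝟙 ↦ 𝟙 + δ u` stays up), so the constant weights
  and the atom weights of the coordinates `j ≠ i` do not see the flip (`wC_flipAt_indLab`, `wA_flipAt_indLab_of_ne`), while
  **`wA i η s (indLab Q b ^ (i,u)) = [η 0 = (|Q| ≤ K)]·[η = b off {0,i}]·[b i = false]·[s = u]`** (`wA_self_flipAt_indLab`).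
* §2 **The mixed closing face** `mixFace Q w i u b = faceVec₄ (indLab Q b) (0,w) (i,u)` with `|Q| = K`, `w ∉ Q`, `b i = true` and ITS
  FUNCTIONAL VALUES: the constant functionals and the atom functionals of the coordinates `j ≠ i` VANISH (`fnl_wC_mixFace`,
  `fnl_wA_mixFace_of_ne`), and **`fnl (wA i η s) (mixFace) = [s = u]·([η = (up@0, !b off {0,i})] − [η = (low@0, !b off {0,i})])`**
  (`fnl_wA_mixFace_self`): a single slot-`u` binomial between two half patterns differing exactly in coordinate `0` — the edges along
  which part XIII walks the spanning trees of the pattern cube.  All [folklore].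

## References
* [Pohlmann1968] H. Pohlmann, Algebraic cycles on abelian varieties of complex multiplication type, Ann. of Math. 88 (1968), Thm 1.
-/

namespace Summit.HodgeConjecture.CorCM.Census.QuarticInversion

open Finset
open Summit.HodgeConjecture.CorCM.Census.OddSliceFacesModel

noncomputable section

variable (A : Type) [Fintype A] [DecidableEq A]

/-! ## §1 Indicator labels flipped in an atom coordinate -/

omit [Fintype A] [DecidableEq A] in
/-- `κ true = 0`. [folklore] -/
@[simp] theorem kb_true : kb A true = 0 := rfl

omit [Fintype A] [DecidableEq A] in
/-- `κ false = 𝟙`. [folklore] -/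
@[simp] theorem kb_false : kb A false = 1 := rfl

omit [Fintype A] in
/-- Flips at different places commute. [folklore] -/
theorem flipAt_comm (p q : Pl A) (Θ : Ty₄ A) : flipAt A p (flipAt A q Θ) = flipAt A q (flipAt A p Θ) :=
  addAt_comm A p.1 q.1 _ _ Θ

/-- **A flip at `(i,u)`, `i ≠ 0`, of an indicator label moves no half** (`|B| ≥ 3`). [folklore] -/
theorem half_coord_flipAt_indLab (h3 : 3 ≤ Fintype.card A) {i : Fin 4} (hi : i ≠ 0) (u : A) (Q : Finset A) (b : Fin 4 → Bool)
    (n : Fin 4) : half A (coord A n (flipAt A (i, u) (indLab A Q b))) = half A (coord A n (indLab A Q b)) := by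
  by_cases hn : n = i
  · subst hn
    rw [coord_flipAt_self, coord_indLab_of_ne A Q b hi]
    cases b n
    · rw [kb_false, half_one_add_delta A h3, half_one A (by omega)]
    · rw [kb_true, zero_add, half_delta A (by omega), half_zero']
  · rw [coord_flipAt_of_ne A hn]

/-- The constant weights do not see the flip at `(i,u)`. [folklore] -/
theorem wC_flipAt_indLab (h3 : 3 ≤ Fintype.card A) {i : Fin 4} (hi : i ≠ 0) (η : Fin 4 → Bool) (u : A) (Q : Finset A)
    (b : Fin 4 → Bool) : wC A η (flipAt A (i, u) (indLab A Q b)) = wC A η (indLab A Q b) :=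
  wC_eq_of_halves A η (half_coord_flipAt_indLab A h3 hi u Q b)

/-- The atom weights of the coordinates `j ≠ i` do not see the flip at `(i,u)`. [folklore] -/
theorem wA_flipAt_indLab_of_ne (h3 : 3 ≤ Fintype.card A) {i j : Fin 4} (hi : i ≠ 0) (hj : j ≠ i) (η : Fin 4 → Bool) (s u : A)
    (Q : Finset A) (b : Fin 4 → Bool) : wA A j η s (flipAt A (i, u) (indLab A Q b)) = wA A j η s (indLab A Q b) := by
  unfold wA wUp
  rw [wMatch_eq_of_halves A j η (half_coord_flipAt_indLab A h3 hi u Q b), coord_flipAt_of_ne A hj]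

/-- The matching condition off an atom coordinate `i ≠ 0` on an indicator label. [folklore] -/
theorem match_off_indLab_iff (h1 : 1 ≤ Fintype.card A) {i : Fin 4} (hi : i ≠ 0) (Q : Finset A) (b η : Fin 4 → Bool) :
    (∀ n, n ≠ i → half A (coord A n (indLab A Q b)) = η n) ↔
      (η 0 = decide (Q.card ≤ Fintype.card A / 2) ∧ ∀ n, n ≠ (0 : Fin 4) → n ≠ i → η n = b n) := by
  constructor
  · intro h
    refine ⟨?_, fun n hn0 hni => ?_⟩
    · have := h 0 hi.symm; rw [coord_zero_indLab, half_ind] at this; exact this.symm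
    · have := h n hni; rw [coord_indLab_of_ne A Q b hn0, half_kb A h1] at this; exact this.symm
  · rintro ⟨h0, h⟩ n hni
    by_cases hn0 : n = 0
    · subst hn0; rw [coord_zero_indLab, half_ind]; exact h0.symm
    · rw [coord_indLab_of_ne A Q b hn0, half_kb A h1]; exact (h n hn0 hni).symm

/-- **The atom weight of coordinate `i` after the flip at `(i,u)`**: `[η 0 = (|Q| ≤ K)]·[η = b off {0,i}]·[b i = false]·[s = u]`
(`𝟙 + δ u` is up with its only zero bit at `u`; `δ u` is low). [folklore] -/
theorem wA_self_flipAt_indLab (h3 : 3 ≤ Fintype.card A) {i : Fin 4} (hi : i ≠ 0) (η : Fin 4 → Bool) (s u : A) (Q : Finset A)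
    (b : Fin 4 → Bool) :
    wA A i η s (flipAt A (i, u) (indLab A Q b)) =
      if (η 0 = decide (Q.card ≤ Fintype.card A / 2) ∧ ∀ n, n ≠ (0 : Fin 4) → n ≠ i → η n = b n) ∧ (b i = false ∧ s = u)
      then 1 else 0 := by
  have hm := match_off_indLab_iff A (by omega) hi Q b η
  have h11 : (1 : ZMod 2) + 1 = 0 := by decide
  have hbit : (half A (coord A i (flipAt A (i, u) (indLab A Q b))) = false ∧ coord A i (flipAt A (i, u) (indLab A Q b)) s = 0) ↔
      (b i = false ∧ s = u) := by
    rw [coord_flipAt_self, coord_indLab_of_ne A Q b hi]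
    cases b i
    · rw [kb_false, half_one_add_delta A h3]
      simp only [Pi.add_apply, Pi.one_apply, delta_apply]
      by_cases hs : s = u <;> simp [hs, h11]
    · rw [kb_true, zero_add, half_delta A (by omega)]
      simp
  unfold wA wUp
  rw [wMatch_eq_of_halves A i η (half_coord_flipAt_indLab A h3 hi u Q b)]
  unfold wMatch
  simp only [hm, hbit]
  by_cases c1 : (η 0 = decide (Q.card ≤ Fintype.card A / 2) ∧ ∀ n, n ≠ (0 : Fin 4) → n ≠ i → η n = b n) <;>
    by_cases c2 : (b i = false ∧ s = u) <;> simp [c1, c2]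

/-! ## §2 The mixed closing face and its functional values -/

/-- **The mixed closing face** through `indLab Q b` at the places `(0,w), (i,u)`. [folklore] -/
def mixFace (Q : Finset A) (w : A) (i : Fin 4) (u : A) (b : Fin 4 → Bool) : Ty₄ A → ℤ := faceVec₄ A (indLab A Q b) (0, w) (i, u)

omit [Fintype A] in
/-- The signed square of a weight at the mixed face. [folklore] -/
theorem sq_mix (w' : Ty₄ A → ℤ) {Q : Finset A} {w : A} (hw : w ∉ Q) (i : Fin 4) (u : A) (b : Fin 4 → Bool) :
    sq A w' (indLab A Q b) (0, w) (i, u) =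
      w' (indLab A Q b) - w' (indLab A (insert w Q) b) - w' (flipAt A (i, u) (indLab A Q b)) +
        w' (flipAt A (i, u) (indLab A (insert w Q) b)) := by
  rw [sq, flipAt_comm A (0, w) (i, u), flipAt_zero_indLab A hw]

/-- The signed square of a weight at the conjugate of the mixed face. [folklore] -/
theorem sq_conj_mix (w' : Ty₄ A → ℤ) {Q : Finset A} {w : A} (hw : w ∉ Q) (i : Fin 4) (u : A) (b : Fin 4 → Bool) :
    sq A w' (conj₄ A (indLab A Q b)) (0, w) (i, u) =
      w' (indLab A Qᶜ (fun n => !b n)) - w' (indLab A (insert w Q)ᶜ (fun n => !b n)) -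
        w' (flipAt A (i, u) (indLab A Qᶜ (fun n => !b n))) + w' (flipAt A (i, u) (indLab A (insert w Q)ᶜ (fun n => !b n))) := by
  rw [sq]
  simp only [← conj₄_flipAt]
  rw [flipAt_comm A (0, w) (i, u), flipAt_zero_indLab A hw]
  simp only [conj₄_flipAt, conj₄_indLab]

/-- The cardinalities along the mixed face (`|Q| = K`, `|B| = 2K + 1`). [folklore] -/
theorem cards_mix {Q : Finset A} {w : A} (hw : w ∉ Q) (hA : Odd (Fintype.card A)) (hQ : Q.card = Fintype.card A / 2) :
    (Q.card ≤ Fintype.card A / 2) ∧ ¬ ((insert w Q).card ≤ Fintype.card A / 2) ∧ ¬ (Qᶜ.card ≤ Fintype.card A / 2) ∧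
      ((insert w Q)ᶜ.card ≤ Fintype.card A / 2) := by
  have c1 : (insert w Q).card = Q.card + 1 := Finset.card_insert_of_notMem hw
  have cc : ∀ R : Finset A, Rᶜ.card = Fintype.card A - R.card := fun R => Finset.card_compl R
  obtain ⟨K, hK⟩ := hA
  rw [cc, cc, c1]; omega

/-- **The constant functionals vanish on the mixed face.** [folklore] -/
theorem fnl_wC_mixFace (h3 : 3 ≤ Fintype.card A) {Q : Finset A} {w : A} (hw : w ∉ Q) {i : Fin 4} (hi : i ≠ 0) (u : A)
    (b η : Fin 4 → Bool) : fnl A (wC A η) (mixFace A Q w i u b) = 0 := by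
  rw [mixFace, fnl_faceVec₄, sq_mix A _ hw, sq_conj_mix A _ hw]
  simp only [wC_flipAt_indLab A h3 hi]
  ring

/-- **The atom functionals of the coordinates `j ≠ i` vanish on the mixed face.** [folklore] -/
theorem fnl_wA_mixFace_of_ne (h3 : 3 ≤ Fintype.card A) {Q : Finset A} {w : A} (hw : w ∉ Q) {i j : Fin 4} (hi : i ≠ 0) (hj : j ≠ i)
    (η : Fin 4 → Bool) (s u : A) (b : Fin 4 → Bool) : fnl A (wA A j η s) (mixFace A Q w i u b) = 0 := by
  rw [mixFace, fnl_faceVec₄, sq_mix A _ hw, sq_conj_mix A _ hw]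
  simp only [wA_flipAt_indLab_of_ne A h3 hi hj]
  ring

/-- **Values of the atom functionals of coordinate `i` on the mixed face**: the slot-`u` binomial
`[s = u]·([η = (up@0, !b off {0,i})] − [η = (low@0, !b off {0,i})])`. [folklore] -/
theorem fnl_wA_mixFace_self (hA : Odd (Fintype.card A)) (h3 : 3 ≤ Fintype.card A) {Q : Finset A} {w : A} (hw : w ∉ Q)
    (hQ : Q.card = Fintype.card A / 2) {i : Fin 4} (hi : i ≠ 0) (η : Fin 4 → Bool) (s u : A) {b : Fin 4 → Bool} (hb : b i = true) :
    fnl A (wA A i η s) (mixFace A Q w i u b) =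
      (if (η 0 = false ∧ ∀ n, n ≠ (0 : Fin 4) → n ≠ i → η n = !b n) ∧ s = u then 1 else 0) -
        (if (η 0 = true ∧ ∀ n, n ≠ (0 : Fin 4) → n ≠ i → η n = !b n) ∧ s = u then 1 else 0) := by
  obtain ⟨cQ, c1, cQc, c1c⟩ := cards_mix A hw hA hQ
  rw [mixFace, fnl_faceVec₄, sq_mix A _ hw, sq_conj_mix A _ hw]
  simp only [wA_ne_indLab A (show 1 ≤ Fintype.card A by omega) hi, wA_self_flipAt_indLab A h3 hi, cQ, c1, cQc, c1c, hb,
    decide_true, decide_false, Bool.not_true, Bool.true_eq_false, false_and, and_false, if_false, sub_self, zero_sub,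
    zero_add, true_and]
  by_cases e0 : η 0 = true <;> by_cases eM : (∀ n, n ≠ (0 : Fin 4) → n ≠ i → η n = !b n) <;> by_cases es : s = u <;>
    simp [e0, eM, es]

end

end Summit.HodgeConjecture.CorCM.Census.QuarticInversion
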